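import Summits.AtomisticToContinuum.Crystallization.Theses.PalmUnimodularRigidity
import Summits.AtomisticToContinuum.Crystallization.Theorems.MinimiserShells.Negative.LoadBearing
import Literature.Probability.Process.PointStationaryLaw
import Literature.Probability.Process.LocallyMatches
import Literature.Geometry.DiscreteGeometry.KissingPatterns

/-!
# Good shells are robust under local matching of hard-core configurations (stub `stub_necessity_robust`, N2)

Stub `stub_necessity_robust` (N2, necessity sandwich) of line `equilibrium-in-law-surgery` (reshape r6)
of crux `MinimiserShells` (stmt-AtomisticToContinuum-9225, route `PalmUnimodularRigidity`).

Statement.  Let `0 < θ ≤ 1/10`, `0 < ε ≤ θ/2`, let `S, S' ⊆ ℝ³` be `1/3`-separated with `0 ∈ S'`,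
and suppose `S` and `S'` are locally `(2, ε)`-matched (`LocallyMatches 2 ε S S'`).  If the root shell
of `count|S` is GOOD (`GoodShell`: scale `a ∈ [9/10, 1]`, the points of `S ∖ {0}` within `5a/4` are
`(a/100)`-matched to a rotated, `a`-scaled FCC or HCP kissing pattern), then the root shell of
`count|S'` is LOOSELY good: the points of `S' ∖ {0}` within `(5/4 − θ)·a` are `(a/100 + θ)`-matched
to the same rotated, scaled pattern (same `a`, same isometry).

Proof (elementary metric geometry, `shell_transfer`, uniform in the pattern `P` of unit vectors).
Pattern points have norm `a`, so shell points `t ∈ T` have `0.99a ≤ ‖t‖ ≤ 1.01a ≤ 2`; the second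
clause of the local matching gives each `t ∈ T` a partner `m t ∈ S'` with `dist t (m t) ≤ ε`.  Then
`m t ≠ 0` (`‖t‖ > ε`), `‖m t‖ ≤ 1.01a + ε ≤ (5/4 − θ)a`, `m` is injective on `T` (two distinct points
of `S` are `≥ 1/3 > 2ε` apart), and `m` maps `T` ONTO the loose shell of `S'`: a point `w ∈ S'`,
`w ≠ 0`, `‖w‖ ≤ (5/4 − θ)a ≤ 2` has `‖w‖ ≥ 1/3` (hard core against the root `0 ∈ S'`) and, by the
first clause, a partner `q ∈ S` within `ε`, so `0 < 1/3 − ε ≤ ‖q‖ ≤ (5/4 − θ)a + ε ≤ 5a/4`, i.e.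
`q ∈ T`, and `dist (m q) w ≤ 2ε < 1/3` forces `m q = w`.  Hence the loose shell is the Finset
`T.image m`, and composing the inverse of the bijection `T ≃ T.image m` with the given matching
`e : T ≃ A(a·P)` moves each point by `≤ ε + a/100 ≤ a/100 + θ`.
-/

noncomputable section

open MeasureTheory
open scoped ENNReal BigOperators Classical

namespace Summit.AtomisticToContinuum.Crystallization.Theorems.PalmUnimodularRigidityMinimiserShells.NecessityRobust

open Literature.Geometry.DiscreteGeometry Literature.Probability.Process
open Summit.AtomisticToContinuum.Crystallization.Theorems.MinimiserShells.Negative.LoadBearing (GoodShell)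

/-! ## Norms of rotated, scaled pattern points -/

/-- A point of the rotated, `a`-scaled copy `A(a·P)` of a pattern `P` of unit vectors has norm `a`
(`a ≥ 0`). -/
theorem norm_eq_of_mem_image_image {a : ℝ} (ha : 0 ≤ a) {P : Finset (EuclideanSpace ℝ (Fin 3))}
    (hP : ∀ v ∈ P, ‖v‖ = 1) (A : EuclideanSpace ℝ (Fin 3) →ₗᵢ[ℝ] EuclideanSpace ℝ (Fin 3))
    {q : EuclideanSpace ℝ (Fin 3)}
    (hq : q ∈ (P.image (fun v : EuclideanSpace ℝ (Fin 3) => a • v)).image A) : ‖q‖ = a := by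
  rw [Finset.mem_image] at hq
  obtain ⟨p, hp, rfl⟩ := hq
  rw [Finset.mem_image] at hp
  obtain ⟨v, hv, rfl⟩ := hp
  rw [LinearIsometry.norm_map, norm_smul, Real.norm_eq_abs, abs_of_nonneg ha, hP v hv, mul_one]

/-! ## The transfer of a good shell along a local matching -/

/-- **Shell transfer.**  For a pattern `P` of unit vectors: if the shell `T = {y ∈ S | y ≠ 0, ‖y‖ ≤ 5a/4}`
of the `1/3`-separated configuration `S` is `(a/100)`-close to `a·P`, and the rooted `1/3`-separated
configuration `S'` is locally `(2, ε)`-matched to `S` (`0 < ε ≤ θ/2`, `0 < θ ≤ 1/10`,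
`9/10 ≤ a ≤ 1`), then the loose shell `{w ∈ S' | w ≠ 0, ‖w‖ ≤ (5/4 − θ)a}` of `S'` is a Finset
`(a/100 + θ)`-close to `a·P` (with the same isometry). -/
theorem shell_transfer {θ ε a : ℝ} {S S' : Set (EuclideanSpace ℝ (Fin 3))} (hθ : 0 < θ)
    (hθ' : θ ≤ 1 / 10) (hε : 0 < ε) (hεθ : ε ≤ θ / 2) (ha : 9 / 10 ≤ a) (ha' : a ≤ 1)
    (h0 : (0 : EuclideanSpace ℝ (Fin 3)) ∈ S')
    (hS : ∀ x ∈ S, ∀ z ∈ S, x ≠ z → (1 : ℝ) / 3 ≤ dist x z)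
    (hS' : ∀ x ∈ S', ∀ z ∈ S', x ≠ z → (1 : ℝ) / 3 ≤ dist x z)
    (hm : LocallyMatches 2 ε S S')
    {P : Finset (EuclideanSpace ℝ (Fin 3))} (hP : ∀ v ∈ P, ‖v‖ = 1)
    {T : Finset (EuclideanSpace ℝ (Fin 3))}
    (hT : (↑T : Set (EuclideanSpace ℝ (Fin 3))) =
      {y : EuclideanSpace ℝ (Fin 3) | y ∈ S ∧ y ≠ 0 ∧ ‖y‖ ≤ 5 / 4 * a})
    (hc : ShellCloseTo (a / 100) T (P.image (fun v : EuclideanSpace ℝ (Fin 3) => a • v))) :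
    ∃ T' : Finset (EuclideanSpace ℝ (Fin 3)), (↑T' : Set (EuclideanSpace ℝ (Fin 3))) =
        {w : EuclideanSpace ℝ (Fin 3) | w ∈ S' ∧ w ≠ 0 ∧ ‖w‖ ≤ (5 / 4 - θ) * a} ∧
      ShellCloseTo (a / 100 + θ) T' (P.image (fun v : EuclideanSpace ℝ (Fin 3) => a • v)) := by
  obtain ⟨A, e, he⟩ := hc
  -- elementary inequalities between the parameters
  have hεθa : ε ≤ θ * a := by nlinarith [mul_le_mul_of_nonneg_left ha hθ.le]
  have hεa : ε + (a + a / 100) ≤ (5 / 4 - θ) * a := by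
    nlinarith [mul_nonneg (sub_nonneg.2 hθ') (sub_nonneg.2 ha)]
  -- membership in the shell `T`
  have hmemT : ∀ y : EuclideanSpace ℝ (Fin 3), y ∈ T ↔ y ∈ S ∧ y ≠ 0 ∧ ‖y‖ ≤ 5 / 4 * a :=
    fun y => by rw [← Finset.mem_coe, hT, Set.mem_setOf_eq]
  -- norms of the rotated, scaled pattern points
  have hQ : ∀ q ∈ (P.image (fun v : EuclideanSpace ℝ (Fin 3) => a • v)).image A, ‖q‖ = a :=
    fun q hq => norm_eq_of_mem_image_image (by linarith) hP A hq
  -- norms of the shell points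
  have hTnorm : ∀ t ∈ T, a - a / 100 ≤ ‖t‖ ∧ ‖t‖ ≤ a + a / 100 := fun t ht => by
    have h1 := abs_norm_sub_norm_le t (e ⟨t, ht⟩ : EuclideanSpace ℝ (Fin 3))
    rw [← dist_eq_norm, hQ _ (e ⟨t, ht⟩).2] at h1
    obtain ⟨h2, h3⟩ := abs_le.1 (h1.trans (he ⟨t, ht⟩))
    exact ⟨by linarith, by linarith⟩
  -- the matching map `m : T → S'`
  have hex : ∀ t ∈ T, ∃ p ∈ S', dist t p ≤ ε := fun t ht =>
    hm.2 t ((hmemT t).1 ht).1 (by linarith [((hmemT t).1 ht).2.2])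
  choose! m hmS' hmd using hex
  -- (1) partners of shell points are not the root
  have hm0 : ∀ t ∈ T, m t ≠ 0 := fun t ht h => by
    have h1 := hmd t ht
    rw [h, dist_zero_right] at h1
    have h2 := (hTnorm t ht).1
    linarith
  -- (2) partners of shell points lie in the loose ball
  have hmnorm : ∀ t ∈ T, ‖m t‖ ≤ (5 / 4 - θ) * a := fun t ht => by
    have h1 : ‖m t‖ - ‖t‖ ≤ dist t (m t) := by
      rw [dist_comm, dist_eq_norm]
      exact norm_sub_norm_le (m t) t
    have h2 := (hTnorm t ht).2
    linarith [hmd t ht]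
  -- (3) the matching map is injective on the shell
  have hminj : ∀ t₁ ∈ T, ∀ t₂ ∈ T, m t₁ = m t₂ → t₁ = t₂ := fun t₁ ht₁ t₂ ht₂ h => by
    by_contra hne
    have h1 := hS t₁ ((hmemT t₁).1 ht₁).1 t₂ ((hmemT t₂).1 ht₂).1 hne
    have h2 : dist t₁ t₂ ≤ dist t₁ (m t₁) + dist t₂ (m t₂) :=
      calc dist t₁ t₂ ≤ dist t₁ (m t₁) + dist (m t₁) t₂ := dist_triangle _ _ _
        _ = dist t₁ (m t₁) + dist t₂ (m t₂) := by rw [h, dist_comm (m t₂)]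
    linarith [hmd t₁ ht₁, hmd t₂ ht₂]
  -- (4) the matching map sends the shell ONTO the loose shell of `S'`
  have hmsurj : ∀ w ∈ S', w ≠ 0 → ‖w‖ ≤ (5 / 4 - θ) * a → ∃ t ∈ T, m t = w :=
      fun w hw hw0 hwn => by
    have hw3 : (1 : ℝ) / 3 ≤ ‖w‖ := by
      have h1 := hS' w hw 0 h0 hw0
      rwa [dist_zero_right] at h1
    have hwn2 : ‖w‖ ≤ 2 := by nlinarith
    obtain ⟨q, hq, hqw⟩ := hm.1 w hw hwn2
    have hq1 : ‖w‖ - ‖q‖ ≤ dist q w := by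
      rw [dist_comm, dist_eq_norm]
      exact norm_sub_norm_le w q
    have hq2 : ‖q‖ - ‖w‖ ≤ dist q w := by
      rw [dist_eq_norm]
      exact norm_sub_norm_le q w
    have hq0 : q ≠ 0 := by
      rintro rfl
      rw [norm_zero] at hq1
      linarith
    have hqT : q ∈ T := (hmemT q).2 ⟨hq, hq0, by linarith⟩
    refine ⟨q, hqT, ?_⟩
    by_contra hne
    have h1 := hS' (m q) (hmS' q hqT) w hw hne
    have h2 : dist (m q) w ≤ dist q (m q) + dist q w :=
      calc dist (m q) w ≤ dist (m q) q + dist q w := dist_triangle _ _ _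
        _ = dist q (m q) + dist q w := by rw [dist_comm (m q)]
    linarith [hmd q hqT]
  -- the bijection `T ≃ T.image m`
  set T' : Finset (EuclideanSpace ℝ (Fin 3)) := T.image m with hT'def
  let f : ↥T → ↥T' := fun t => ⟨m t, Finset.mem_image_of_mem m t.2⟩
  have hf : Function.Bijective f := by
    refine ⟨fun t₁ t₂ h => Subtype.ext (hminj _ t₁.2 _ t₂.2 (congrArg Subtype.val h)), fun w => ?_⟩
    obtain ⟨t, ht, htw⟩ := Finset.mem_image.1 w.2
    exact ⟨⟨t, ht⟩, Subtype.ext htw⟩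
  refine ⟨T', ?_, A, (Equiv.ofBijective f hf).symm.trans e, fun w => ?_⟩
  · -- the loose shell of `S'` is `T.image m`
    ext w
    simp only [hT'def, Finset.coe_image, Set.mem_image, Finset.mem_coe, Set.mem_setOf_eq]
    constructor
    · rintro ⟨t, ht, rfl⟩
      exact ⟨hmS' t ht, hm0 t ht, hmnorm t ht⟩
    · rintro ⟨hw, hw0, hwn⟩
      exact hmsurj w hw hw0 hwn
  · -- each loose-shell point is within `ε + a/100` of its pattern point
    set t : ↥T := (Equiv.ofBijective f hf).symm w with htdef
    have hw : m (t : EuclideanSpace ℝ (Fin 3)) = (w : EuclideanSpace ℝ (Fin 3)) := by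
      have h1 := Equiv.ofBijective_apply_symm_apply f hf w
      rw [← htdef] at h1
      exact congrArg Subtype.val h1
    rw [Equiv.trans_apply, ← htdef]
    calc dist (w : EuclideanSpace ℝ (Fin 3)) (e t : EuclideanSpace ℝ (Fin 3))
          ≤ dist (w : EuclideanSpace ℝ (Fin 3)) (t : EuclideanSpace ℝ (Fin 3)) +
            dist (t : EuclideanSpace ℝ (Fin 3)) (e t : EuclideanSpace ℝ (Fin 3)) :=
          dist_triangle _ _ _
      _ ≤ ε + a / 100 := by
          gcongr
          · rw [← hw, dist_comm]
            exact hmd t t.2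
          · exact he t
      _ ≤ a / 100 + θ := by linarith

/-! ## The registered stub -/

/-- **stub_necessity_robust** (N2, necessity sandwich).  ROBUSTNESS OF GOOD SHELLS under local
matching: if a `1/3`-hard-core configuration `S` has a good root shell and the rooted `1/3`-hard-core
configuration `S'` is locally `(2, ε)`-matched to `S` with `0 < ε ≤ θ/2`, `0 < θ ≤ 1/10`, then `S'`
has a LOOSELY good root shell at tolerance `θ`: same scale `a`, radius `(5/4 − θ)·a`, matching
tolerance `a/100 + θ` (`shell_transfer`, applied to the FCC or the HCP pattern). -/
theorem stub_necessity_robust :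
    ∀ θ : ℝ, 0 < θ → θ ≤ 1 / 10 → ∀ ε : ℝ, 0 < ε → ε ≤ θ / 2 →
      ∀ S S' : Set (EuclideanSpace ℝ (Fin 3)), (0 : EuclideanSpace ℝ (Fin 3)) ∈ S' →
        (∀ x ∈ S, ∀ z ∈ S, x ≠ z → (1 : ℝ) / 3 ≤ dist x z) →
        (∀ x ∈ S', ∀ z ∈ S', x ≠ z → (1 : ℝ) / 3 ≤ dist x z) →
        Literature.Probability.Process.LocallyMatches 2 ε S S' →
        GoodShell ((Measure.count : Measure (EuclideanSpace ℝ (Fin 3))).restrict S) →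
        (∃ a : ℝ, 9 / 10 ≤ a ∧ a ≤ 1 ∧ ∃ T : Finset (EuclideanSpace ℝ (Fin 3)),
            (↑T : Set (EuclideanSpace ℝ (Fin 3))) = {w : EuclideanSpace ℝ (Fin 3) | ((Measure.count : Measure (EuclideanSpace ℝ (Fin 3))).restrict S') {w} ≠ 0 ∧ w ≠ 0 ∧ ‖w‖ ≤ (5 / 4 - θ) * a} ∧
            (Literature.Geometry.DiscreteGeometry.ShellCloseTo (a / 100 + θ) T
              (Finset.image (fun v : EuclideanSpace ℝ (Fin 3) => a • v) Literature.Geometry.DiscreteGeometry.fccKissingPattern) ∨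
             Literature.Geometry.DiscreteGeometry.ShellCloseTo (a / 100 + θ) T
              (Finset.image (fun v : EuclideanSpace ℝ (Fin 3) => a • v) Literature.Geometry.DiscreteGeometry.hcpKissingPattern))) := by
  intro θ hθ hθ' ε hε hεθ S S' h0 hS hS' hm hgood
  obtain ⟨a, ha, ha', T, hT, hclose⟩ := hgood
  simp_rw [count_restrict_singleton_ne_zero_iff] at hT ⊢
  refine ⟨a, ha, ha', ?_⟩
  rcases hclose with hc | hc
  · obtain ⟨T', hT', hc'⟩ := shell_transfer hθ hθ' hε hεθ ha ha' h0 hS hS' hm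
      (fun v hv => norm_eq_one_of_mem_fccKissingPattern hv) hT hc
    exact ⟨T', hT', Or.inl hc'⟩
  · obtain ⟨T', hT', hc'⟩ := shell_transfer hθ hθ' hε hεθ ha ha' h0 hS hS' hm
      (fun v hv => norm_eq_one_of_mem_hcpKissingPattern hv) hT hc
    exact ⟨T', hT', Or.inr hc'⟩

end Summit.AtomisticToContinuum.Crystallization.Theorems.PalmUnimodularRigidityMinimiserShells.NecessityRobust

end
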